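import Summits.CriticalPhenomena.PercolationContinuityZ3.Theorems.PercNearOneGluingNoHeavyLowerTailThreePartitionVOrderKernel
import Summits.CriticalPhenomena.PercolationContinuityZ3.Theorems.PercNearOneGluingNoHeavyLowerTailThreePartitionVOrderPrincipal

/-!
# THEOREM P in the language of Conjecture V: `vSumT ∅ 𝒱 𝒲 𝒳 ≥ 0` for every PRINCIPAL up-set `𝒳` of the copy order

Support file (lineage `prim-bnk-2`, generation 33; `--supports stmt-CriticalPhenomena-4575`; memo
`run/shared/lean/prim/prim-l12/FROM-prim-bnk-2-g33-CONJ-W.md` §3, §6).  No `sorry`, no new definitions, standard axioms.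

`…ThreePartitionVOrderPrincipal` proves THEOREM P as an inequality between finset double sums; `…ThreePartitionVOrderKernel`
writes `vSumT` as the face sum of the kernel (`vSumT_eq_vSumTZ`).  Here the two are connected: for all up-sets `𝒱, 𝒲 ⊆ Set (Set ι)`
and all `x₀, y₀`, the untwisted kernel sum over the principal up-set `{(a,b) : x₀ ⊆ a, y₀ ⊆ b}` of the copy order — the faces
with `x ⊇ x₀`, `y ⊇ y₀`, i.e. all subfaces of the face `(x₀ | y₀ | (x₀ ∪ y₀)ᶜ)` — is `≥ 0` (`vSumT_empty_nonneg_of_principal`):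
Conjecture V (`VOrderPositivity`) restricted to `τ = ∅` and principal `𝒳`, for ALL pairs `𝒱, 𝒲`. [this work]
-/

noncomputable section

open Finset
open scoped symmDiff Classical

namespace Summit.CriticalPhenomena.PercolationContinuityZ3.Theorems.ThreePartition

variable {ι : Type*} [Fintype ι]

omit [Fintype ι] in
/-- `s ∆ ∅ = s` for sets. [this work] -/
theorem set_symmDiff_empty (s : Set ι) : s ∆ (∅ : Set ι) = s := symmDiff_bot s

/-- Membership in `facesIn`. [this work] -/
theorem mem_facesIn_iff (τ : Set ι) (𝒳 : Set (Set ι × Set ι)) (q : Set ι × Set ι) :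
    q ∈ facesIn τ 𝒳 ↔ Disjoint q.1 q.2 ∧ (q.1 ∆ τ, q.2 ∆ τ) ∈ 𝒳 := by
  unfold facesIn
  simp only [Finset.mem_filter, Finset.mem_univ, true_and]

/-- The face sum of a kernel over a principal up-set, re-indexed by the ordered 3-partitions `(g,h,w)` of
`z₀ = (x₀ ∪ y₀)ᶜ` (faces `(x₀ ∪ g | y₀ ∪ h | w)`), for disjoint `x₀, y₀`. [this work] -/
theorem vSumTZ_empty_principal_eq (Z : Set ι → Set ι → ℤ) (x₀ y₀ : Finset ι) (hxy : Disjoint x₀ y₀) :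
    vSumTZ ∅ Z {q : Set ι × Set ι | (↑x₀ : Set ι) ⊆ q.1 ∧ (↑y₀ : Set ι) ⊆ q.2} =
      ∑ g ∈ ((x₀ ∪ y₀)ᶜ).powerset, ∑ h ∈ ((x₀ ∪ y₀)ᶜ \ g).powerset,
        (2 * Z ↑(x₀ ∪ g) ↑(x₀ ∪ g) + Z ↑(((x₀ ∪ y₀)ᶜ \ g) \ h) ↑(y₀ ∪ h) - Z ↑(((x₀ ∪ y₀)ᶜ \ g) \ h) ↑(x₀ ∪ g)
          - Z ↑(x₀ ∪ g) ↑(((x₀ ∪ y₀)ᶜ \ g) \ h) - Z ↑(((x₀ ∪ y₀)ᶜ \ g) \ h) ↑(((x₀ ∪ y₀)ᶜ \ g) \ h)) := by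
  set z₀ : Finset ι := (x₀ ∪ y₀)ᶜ with hz₀
  set 𝒳 : Set (Set ι × Set ι) := {q | (↑x₀ : Set ι) ⊆ q.1 ∧ (↑y₀ : Set ι) ⊆ q.2} with h𝒳
  -- the index set of pairs `(g,h)`
  set r : Finset (Finset ι × Finset ι) := (z₀.powerset ×ˢ z₀.powerset).filter (fun p => p.2 ⊆ z₀ \ p.1) with hr
  have hmemr : ∀ p : Finset ι × Finset ι, p ∈ r ↔ p.1 ∈ z₀.powerset ∧ p.2 ∈ (z₀ \ p.1).powerset := by
    intro p
    rw [hr, Finset.mem_filter, Finset.mem_product, Finset.mem_powerset, Finset.mem_powerset, Finset.mem_powerset]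
    constructor
    · rintro ⟨⟨h1, _⟩, h3⟩; exact ⟨h1, h3⟩
    · rintro ⟨h1, h3⟩; exact ⟨⟨h1, h3.trans Finset.sdiff_subset⟩, h3⟩
  rw [← Finset.sum_finset_product' r z₀.powerset (fun g => (z₀ \ g).powerset) hmemr]
  unfold vSumTZ
  -- bijection `facesIn ∅ 𝒳 ≃ r`
  symm
  refine Finset.sum_bij' (fun p _ => ((↑(x₀ ∪ p.1) : Set ι), (↑(y₀ ∪ p.2) : Set ι)))
    (fun q _ => ((Finset.univ.filter fun i => i ∈ q.1) \ x₀, (Finset.univ.filter fun i => i ∈ q.2) \ y₀))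
    ?_ ?_ ?_ ?_ ?_
  · -- image lies in `facesIn`
    intro p hp
    rw [hmemr, Finset.mem_powerset, Finset.mem_powerset] at hp
    obtain ⟨hg, hh⟩ := hp
    rw [mem_facesIn_iff]
    refine ⟨?_, ?_⟩
    · rw [Finset.disjoint_coe]
      rw [Finset.disjoint_left]
      intro i hi hi'
      rw [Finset.mem_union] at hi hi'
      have hgz : ∀ j ∈ p.1, j ∈ z₀ := fun j hj => hg hj
      have hhz : ∀ j ∈ p.2, j ∈ z₀ \ p.1 := fun j hj => hh hj
      rcases hi with hix | hig
      · rcases hi' with hiy | hih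
        · exact Finset.disjoint_left.1 hxy hix hiy
        · have := (Finset.mem_sdiff.1 (hhz i hih)).1
          rw [hz₀, Finset.mem_compl, Finset.mem_union] at this
          exact this (Or.inl hix)
      · rcases hi' with hiy | hih
        · have := hgz i hig
          rw [hz₀, Finset.mem_compl, Finset.mem_union] at this
          exact this (Or.inr hiy)
        · exact (Finset.mem_sdiff.1 (hhz i hih)).2 hig
    · simp only [set_symmDiff_empty, h𝒳, Set.mem_setOf_eq, Finset.coe_union]
      exact ⟨Set.subset_union_left, Set.subset_union_left⟩
  · -- preimage lies in `r`
    intro q hq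
    rw [mem_facesIn_iff] at hq
    obtain ⟨hdis, hmem⟩ := hq
    simp only [set_symmDiff_empty, h𝒳, Set.mem_setOf_eq] at hmem
    rw [hmemr, Finset.mem_powerset, Finset.mem_powerset]
    constructor
    · intro i hi
      rw [Finset.mem_sdiff, Finset.mem_filter] at hi
      rw [hz₀, Finset.mem_compl, Finset.mem_union]
      rintro (hix | hiy)
      · exact hi.2 hix
      · exact Set.disjoint_left.1 hdis hi.1.2 (hmem.2 (Finset.mem_coe.2 hiy))
    · intro i hi
      rw [Finset.mem_sdiff, Finset.mem_filter] at hi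
      rw [Finset.mem_sdiff, hz₀, Finset.mem_compl, Finset.mem_union, Finset.mem_sdiff, Finset.mem_filter]
      refine ⟨?_, ?_⟩
      · rintro (hix | hiy)
        · exact Set.disjoint_left.1 hdis (hmem.1 (Finset.mem_coe.2 hix)) hi.1.2
        · exact hi.2 hiy
      · rintro ⟨⟨_, hi1⟩, _⟩
        exact Set.disjoint_left.1 hdis hi1 hi.1.2
  · -- left inverse on `r`
    intro p hp
    rw [hmemr, Finset.mem_powerset, Finset.mem_powerset] at hp
    obtain ⟨hg, hh⟩ := hp
    ext i
    · simp only [Finset.mem_sdiff, Finset.mem_filter, Finset.mem_univ, true_and, Finset.coe_union, Set.mem_union,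
        Finset.mem_coe]
      constructor
      · rintro ⟨hi | hi, hni⟩
        · exact absurd hi hni
        · exact hi
      · intro hi
        refine ⟨Or.inr hi, fun hix => ?_⟩
        have := hg hi
        rw [hz₀, Finset.mem_compl, Finset.mem_union] at this
        exact this (Or.inl hix)
    · simp only [Finset.mem_sdiff, Finset.mem_filter, Finset.mem_univ, true_and, Finset.coe_union, Set.mem_union,
        Finset.mem_coe]
      constructor
      · rintro ⟨hi | hi, hni⟩
        · exact absurd hi hni
        · exact hi
      · intro hi
        refine ⟨Or.inr hi, fun hiy => ?_⟩
        have := (Finset.mem_sdiff.1 (hh hi)).1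
        rw [hz₀, Finset.mem_compl, Finset.mem_union] at this
        exact this (Or.inr hiy)
  · -- right inverse on `facesIn`
    intro q hq
    rw [mem_facesIn_iff] at hq
    obtain ⟨_, hmem⟩ := hq
    simp only [set_symmDiff_empty, h𝒳, Set.mem_setOf_eq] at hmem
    ext i
    · simp only [Finset.coe_union, Finset.coe_sdiff, Finset.coe_filter, Finset.mem_univ, true_and, Set.mem_union,
        Set.mem_sdiff, Set.mem_setOf_eq, Finset.mem_coe]
      constructor
      · rintro (hix | ⟨hi, _⟩)
        · exact hmem.1 (Finset.mem_coe.2 hix)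
        · exact hi
      · intro hi
        by_cases hix : i ∈ x₀
        · exact Or.inl hix
        · exact Or.inr ⟨hi, hix⟩
    · simp only [Finset.coe_union, Finset.coe_sdiff, Finset.coe_filter, Finset.mem_univ, true_and, Set.mem_union,
        Set.mem_sdiff, Set.mem_setOf_eq, Finset.mem_coe]
      constructor
      · rintro (hiy | ⟨hi, _⟩)
        · exact hmem.2 (Finset.mem_coe.2 hiy)
        · exact hi
      · intro hi
        by_cases hiy : i ∈ y₀
        · exact Or.inl hiy
        · exact Or.inr ⟨hi, hiy⟩
  · -- summands agree
    intro p hp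
    rw [hmemr, Finset.mem_powerset, Finset.mem_powerset] at hp
    obtain ⟨hg, hh⟩ := hp
    have hc : ((↑(x₀ ∪ p.1) : Set ι) ∪ ↑(y₀ ∪ p.2))ᶜ = ↑((z₀ \ p.1) \ p.2) := by
      ext i
      simp only [Set.mem_compl_iff, Set.mem_union, Finset.coe_union, Finset.mem_coe, Finset.coe_sdiff, Set.mem_sdiff,
        hz₀, Finset.mem_compl, Finset.mem_union]
      tauto
    unfold kerZ
    simp only [set_symmDiff_empty, hc]

/-- **THEOREM P in Conjecture-V form.**  For all up-sets `𝒱, 𝒲` and all `x₀, y₀`, the untwisted kernel sum of Conjecture V over the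
principal up-set `{(a,b) : x₀ ⊆ a, y₀ ⊆ b}` of the copy order (all subfaces of the face `(x₀ | y₀ | (x₀∪y₀)ᶜ)`; empty if
`x₀ ∩ y₀ ≠ ∅`) is nonnegative: `vSumT ∅ 𝒱 𝒲 {(a,b) : x₀ ⊆ a, y₀ ⊆ b} ≥ 0`. [this work] -/
theorem vSumT_empty_nonneg_of_principal (𝒱 𝒲 : Set (Set ι)) (h𝒱 : IsUpperSet 𝒱) (h𝒲 : IsUpperSet 𝒲)
    (x₀ y₀ : Finset ι) :
    0 ≤ vSumT ∅ 𝒱 𝒲 {q : Set ι × Set ι | (↑x₀ : Set ι) ⊆ q.1 ∧ (↑y₀ : Set ι) ⊆ q.2} := by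
  rw [vSumT_eq_vSumTZ]
  by_cases hxy : Disjoint x₀ y₀
  · rw [vSumTZ_empty_principal_eq _ x₀ y₀ hxy]
    -- the weights `b(S) = [↑S ∈ 𝒱]`, `c(S) = [↑S ∈ 𝒲]`
    have key := principal_kernel_sum_nonneg (fun S : Finset ι => if (↑S : Set ι) ∈ 𝒱 then (1 : ℤ) else 0)
      (fun S : Finset ι => if (↑S : Set ι) ∈ 𝒲 then (1 : ℤ) else 0)
      (fun S => by split_ifs <;> norm_num) (fun S => by split_ifs <;> norm_num)
      (fun S T hST => by
        simp only
        by_cases hS : (↑S : Set ι) ∈ 𝒱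
        · rw [if_pos hS, if_pos (h𝒱 (Finset.coe_subset.2 hST) hS)]
        · rw [if_neg hS]; split_ifs <;> norm_num)
      (fun S T hST => by
        simp only
        by_cases hS : (↑S : Set ι) ∈ 𝒲
        · rw [if_pos hS, if_pos (h𝒲 (Finset.coe_subset.2 hST) hS)]
        · rw [if_neg hS]; split_ifs <;> norm_num)
      x₀ y₀ (x₀ ∪ y₀)ᶜ
    refine le_trans key (le_of_eq ?_)
    refine Finset.sum_congr rfl fun g _ => Finset.sum_congr rfl fun h _ => ?_
    unfold indicatorZ
    generalize ((↑(x₀ ∪ g) : Set ι) ∈ 𝒱) = A1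
    generalize ((↑(x₀ ∪ g) : Set ι) ∈ 𝒲) = A2
    generalize ((↑(((x₀ ∪ y₀)ᶜ \ g) \ h) : Set ι) ∈ 𝒱) = C1
    generalize ((↑(((x₀ ∪ y₀)ᶜ \ g) \ h) : Set ι) ∈ 𝒲) = C2
    generalize ((↑(y₀ ∪ h) : Set ι) ∈ 𝒲) = B2
    by_cases a1 : A1 <;> by_cases a2 : A2 <;> by_cases c1 : C1 <;> by_cases c2 : C2 <;> by_cases b2 : B2 <;>
      simp [a1, a2, c1, c2, b2]
  · -- no face has `x ⊇ x₀`, `y ⊇ y₀` when `x₀ ∩ y₀ ≠ ∅`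
    have hempty : facesIn ∅ {q : Set ι × Set ι | (↑x₀ : Set ι) ⊆ q.1 ∧ (↑y₀ : Set ι) ⊆ q.2} = ∅ := by
      rw [Finset.eq_empty_iff_forall_notMem]
      intro q hq
      rw [mem_facesIn_iff] at hq
      obtain ⟨hdis, hmem⟩ := hq
      simp only [set_symmDiff_empty, Set.mem_setOf_eq] at hmem
      apply hxy
      rw [Finset.disjoint_left]
      intro i hix hiy
      exact Set.disjoint_left.1 hdis (hmem.1 (Finset.mem_coe.2 hix)) (hmem.2 (Finset.mem_coe.2 hiy))
    unfold vSumTZ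
    rw [hempty, Finset.sum_empty]

end Summit.CriticalPhenomena.PercolationContinuityZ3.Theorems.ThreePartition
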